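import Literature.NumberTheory.CubicFields.DivisibleOrbitFamilies
import Literature.NumberTheory.CubicFields.StabilizerCardBound
import Literature.NumberTheory.CubicFields.ShintaniZetaResidues
import Literature.NumberTheory.CubicFields.ShintaniDualDensityBounds
import Literature.NumberTheory.CubicFields.ShintaniCoeffPositivity
import Literature.NumberTheory.CubicFields.UniformityMaximalReductionProofs
import HarnessLib

/-!
# The functions `Φ_{d,m} = 𝟙_{m²d ∣ Disc}`: Theorem 2.4 (ii), (iii) as a schema, and the large-height count from Theorem 3.2

Topic `Literature/NumberTheory/CubicFields`; built on `ShintaniZetaResidues.lean` (the continuation/residue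
vocabulary `IsShintaniEntire`, `shintaniRes1`, `shintaniRes56`, the constants `α^±, β, γ^±`, the factors
`resFactor1 m = ∏_{p∣m}(2p⁻² − p⁻⁴)`, `resFactor56 m`), `ShintaniDualDensity(Bounds).lean` (`LandauAverageBound` = Thm 3.2
as a predicate, `dualDensity = δ̂₁`, `shintaniPartialSum = N^±(X, Φ)`), `StabilizerCardBound.lean` (`|Stab(f)| ≤ 12`),
`UniformityMaximalReductionProofs.lean` (`#⋃ orbitsOfDisc = Σ h(D)`), `DivisibleOrbitFamilies.lean` (`divFam`,
`DivCountBound`). Everything here is PROVED except the hypothesis schema `HasDivResidues` (nothing asserted).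

Bhargava–Taniguchi–Thorne 2023. Theorem 2.4 (p. 10) gives, "for functions of the form `Φ_m = ⊗_{p^a ∥ m} Φ_{p^a}`",
`Res_{s=1} ξ^±(s, Φ_m) = α^± 𝒜(Φ_m) + β ℬ(Φ_m)`, `Res_{s=5/6} = γ^± 𝒞(Φ_m)` with the local factors multiplicative, and
lists: "for the characteristic function `Φ_{p²}` of those `x` with `p² ∣ Disc(x)`: `𝒜 = ℬ = 2p⁻² − p⁻⁴`,
`𝒞 = p^{-5/3} + 2p⁻² − p^{-8/3} − p⁻³`; for the characteristic function `Φ_p` of those `x` with `p ∣ Disc(x)`: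
`𝒜 = ℬ = p⁻¹ + p⁻² − p⁻³`, `𝒞 = p⁻¹ + p^{-4/3} − p^{-7/3}`." Proposition 4.7: "`#{x ∈ V(ℤ) : 0 < ±Disc(x) < X, q ∣ Disc(x)}
≪ X/q`" for cubefree `q < X^{1/4−ε}`, used in the proof of Prop. 5.1 for `N > Q^{100}` ("Proposition 4.7 more than
suffices"). Here the needed count is obtained directly from Theorem 3.2 applied to the single pair `(Φ_{d,m}, Y)`:

* `divIndicator d m` (`Φ_{d,m}` on `V(ℤ/m²dℤ)`), `resFactor1Div d`, `resFactor56Div d` and their sizes;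
  `HasDivResidues d m sgn` — the schema (continuation + the two residue formulas);
* `ncard_divFam_le_re_partialSum` — `#{orbits : 0 < α Disc < Y, m² ∣ Disc, d ∣ Disc} ≤ 12 · N^α(Y, Φ_{d,m})`
  (every Shintani weight is `≥ 1/12`);
* `dualDensity_le_explicit` — `δ̂₁(Φ) ≤ M⁴ · 2BC` for `|Φ| ≤ B` (Prop. 4.5 at `q = 1`);
* `HasDivResidues.hyp16` — hypothesis (16) of Thm 3.1 holds for `Y ≥ (m²d)⁵` (`2^{ω(d)} ≤ d^{5/6}`, `4^{ω(m)} ≤ m^{4/3}`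
  for `d, m` prime to `6`);
* **`divCountBound_of_landau`** — `∃ C K ≥ 0, DivCountBound C K` from `btt_uniformity_sqDvd`, Theorem 3.2
  (`∀ c₁₆ c₁₉ c_L c_U > 0, ∃ C, LandauAverageBound …`) and `∀ d m … sgn, HasDivResidues d m sgn`:
  `N(Y, Φ) ≤ Res₁ Y + (6/5)|Res_{5/6}| Y^{5/6} + C Y^{3/5} Res₁^{3/5} δ̂₁^{2/5} ≤ (1 + (6/5)c₁₆ + C) Res₁ Y` and
  `Res₁ ≤ (α⁻ + β) 2^{ω(md)}/(m²d)`.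

## References

* M. Bhargava, T. Taniguchi, F. Thorne, *Improved error estimates for the Davenport–Heilbronn theorems*,
  Math. Ann. 389 (2024) = arXiv:2107.12819, Thm 2.4 (13), (14), Thm 3.1 (16)–(19), Thm 3.2, Prop. 4.7, §5 [BhargavaTaniguchiThorne2023].
* T. Taniguchi, F. Thorne, *Orbital L-functions for the space of binary cubic forms*, Canad. J. Math. 65 (2013),
  Props. 8.14, 8.15 (the local densities) [TaniguchiThorne2013orbital].
-/

noncomputable section

namespace Literature.NumberTheory.CubicFields

open BinaryCubic Finset Classical
open Literature.NumberTheory.Sieve.SmoothArcs (rpow_of_squarefree)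

/-! ## The large-height divisibility count from Thm 3.2 and Thm 2.4 (ii), (iii) -/

section DivResidues

/-! ### The functions `Φ_{d,m} = 𝟙_{m²d ∣ Disc}` on `V(ℤ/m²dℤ)` and their residue factors -/

/-- **`Φ_{d,m} : V(ℤ/m²dℤ) → {0, 1}`**, the characteristic function of `m² d ∣ Disc` — for coprime squarefree `d, m`
the product `⊗_{p∣d} Φ_p ⊗ ⊗_{p∣m} Φ_{p²}` of the local characteristic functions of `p ∣ Disc` on `V(ℤ/pℤ)` and of
`p² ∣ Disc` on `V(ℤ/p²ℤ)` of BTT Thm 2.4 (cases "`p ∣ Disc(x)`" and "`p² ∣ Disc(x)`").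
[cite: BhargavaTaniguchiThorne2023, Thm 2.4 (the characteristic functions Φ_p of p ∣ Disc and Φ_{p²} of p² ∣ Disc)] -/
def divIndicator (d m : ℕ) (y : BinaryCubic (ZMod (m ^ 2 * d))) : ℂ :=
  if y.disc = 0 then 1 else 0

/-- `Φ_{d,m}` is nonnegative real. [folklore] -/
theorem divIndicator_nonneg (d m : ℕ) (y : BinaryCubic (ZMod (m ^ 2 * d))) :
    0 ≤ (divIndicator d m y).re ∧ (divIndicator d m y).im = 0 := by
  unfold divIndicator; split_ifs <;> simp

/-- `|Φ_{d,m}| ≤ 1`. [folklore] -/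
theorem norm_divIndicator_le (d m : ℕ) (y : BinaryCubic (ZMod (m ^ 2 * d))) : ‖divIndicator d m y‖ ≤ 1 := by
  unfold divIndicator; split_ifs <;> simp

/-- `Φ_{d,m}` is `GL₂`-invariant (`Disc(γ·y) = (det γ)^{10} Disc y`). [folklore] -/
theorem divIndicator_twist (d m : ℕ) {γ : Matrix (Fin 2) (Fin 2) (ZMod (m ^ 2 * d))} (hγ : IsUnit γ.det)
    (y : BinaryCubic (ZMod (m ^ 2 * d))) : divIndicator d m (twist γ y) = divIndicator d m y := by
  simp only [divIndicator, disc_twist, (hγ.pow 10).mul_right_eq_zero]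

/-- On an integral form of discriminant divisible by `m²d`, `Φ_{d,m}` is `1`. [folklore] -/
theorem divIndicator_map_eq_one {d m : ℕ} {f : BinaryCubic ℤ} (h : ((m ^ 2 * d : ℕ) : ℤ) ∣ f.disc) :
    divIndicator d m (f.map (Int.castRingHom (ZMod (m ^ 2 * d)))) = 1 := by
  unfold divIndicator
  rw [disc_map, if_pos]
  rw [eq_intCast, ZMod.intCast_zmod_eq_zero_iff_dvd]
  exact h

/-- `𝒜(Φ_d) = ℬ(Φ_d) = ∏_{p∣d} (p⁻¹ + p⁻² − p⁻³)` (BTT Thm 2.4, case `p ∣ Disc`). [cite: BhargavaTaniguchiThorne2023, Thm 2.4 (𝒜(Φ_p) = ℬ(Φ_p) = p⁻¹ + p⁻² − p⁻³)] -/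
def resFactor1Div (d : ℕ) : ℝ :=
  ∏ p ∈ d.primeFactors, ((p : ℝ) ^ (-1 : ℝ) + (p : ℝ) ^ (-2 : ℝ) - (p : ℝ) ^ (-3 : ℝ))

/-- `𝒞(Φ_d) = ∏_{p∣d} (p⁻¹ + p^{-4/3} − p^{-7/3})` (BTT Thm 2.4, case `p ∣ Disc`). [cite: BhargavaTaniguchiThorne2023, Thm 2.4 (𝒞(Φ_p) = p⁻¹ + p^{-4/3} − p^{-7/3})] -/
def resFactor56Div (d : ℕ) : ℝ :=
  ∏ p ∈ d.primeFactors, ((p : ℝ) ^ (-1 : ℝ) + (p : ℝ) ^ (-(4 : ℝ) / 3) - (p : ℝ) ^ (-(7 : ℝ) / 3))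

/-- `p⁻¹ ≤ p⁻¹ + p⁻² − p⁻³ ≤ 2p⁻¹` for a prime `p`. [folklore] -/
theorem rpow_neg_one_le_factor1Div {p : ℕ} (hp : p.Prime) :
    (p : ℝ) ^ (-1 : ℝ) ≤ (p : ℝ) ^ (-1 : ℝ) + (p : ℝ) ^ (-2 : ℝ) - (p : ℝ) ^ (-3 : ℝ) ∧
      (p : ℝ) ^ (-1 : ℝ) + (p : ℝ) ^ (-2 : ℝ) - (p : ℝ) ^ (-3 : ℝ) ≤ 2 * (p : ℝ) ^ (-1 : ℝ) := by
  have hp1 : (1 : ℝ) ≤ p := by exact_mod_cast hp.one_lt.le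
  have h32 : (p : ℝ) ^ (-3 : ℝ) ≤ (p : ℝ) ^ (-2 : ℝ) := Real.rpow_le_rpow_of_exponent_le hp1 (by norm_num)
  have h21 : (p : ℝ) ^ (-2 : ℝ) ≤ (p : ℝ) ^ (-1 : ℝ) := Real.rpow_le_rpow_of_exponent_le hp1 (by norm_num)
  have h3 : 0 ≤ (p : ℝ) ^ (-3 : ℝ) := Real.rpow_nonneg (by positivity) _
  constructor <;> linarith

/-- `p⁻¹ ≤ p⁻¹ + p^{-4/3} − p^{-7/3} ≤ 2p⁻¹` for a prime `p`. [folklore] -/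
theorem rpow_neg_one_le_factor56Div {p : ℕ} (hp : p.Prime) :
    (p : ℝ) ^ (-1 : ℝ) ≤ (p : ℝ) ^ (-1 : ℝ) + (p : ℝ) ^ (-(4 : ℝ) / 3) - (p : ℝ) ^ (-(7 : ℝ) / 3) ∧
      (p : ℝ) ^ (-1 : ℝ) + (p : ℝ) ^ (-(4 : ℝ) / 3) - (p : ℝ) ^ (-(7 : ℝ) / 3) ≤ 2 * (p : ℝ) ^ (-1 : ℝ) := by
  have hp1 : (1 : ℝ) ≤ p := by exact_mod_cast hp.one_lt.le
  have h74 : (p : ℝ) ^ (-(7 : ℝ) / 3) ≤ (p : ℝ) ^ (-(4 : ℝ) / 3) := Real.rpow_le_rpow_of_exponent_le hp1 (by norm_num)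
  have h41 : (p : ℝ) ^ (-(4 : ℝ) / 3) ≤ (p : ℝ) ^ (-1 : ℝ) := Real.rpow_le_rpow_of_exponent_le hp1 (by norm_num)
  have h7 : 0 ≤ (p : ℝ) ^ (-(7 : ℝ) / 3) := Real.rpow_nonneg (by positivity) _
  constructor <;> linarith

/-- `d⁻¹ ≤ ∏_{p∣d}(p⁻¹ + p⁻² − p⁻³)` for squarefree `d`. [folklore] -/
theorem rpow_neg_one_le_resFactor1Div {d : ℕ} (hd : Squarefree d) : (d : ℝ) ^ (-1 : ℝ) ≤ resFactor1Div d := by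
  rw [rpow_of_squarefree hd _, resFactor1Div]
  exact Finset.prod_le_prod (fun p _ => by positivity) fun p hp => (rpow_neg_one_le_factor1Div (Nat.prime_of_mem_primeFactors hp)).1

/-- `0 < ∏_{p∣d}(p⁻¹ + p⁻² − p⁻³)`. [folklore] -/
theorem resFactor1Div_pos (d : ℕ) : 0 < resFactor1Div d := by
  unfold resFactor1Div
  refine Finset.prod_pos fun p hp => ?_
  have hpr := Nat.prime_of_mem_primeFactors hp
  exact lt_of_lt_of_le (Real.rpow_pos_of_pos (by exact_mod_cast hpr.pos) _) (rpow_neg_one_le_factor1Div hpr).1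

/-- `∏_{p∣d}(p⁻¹ + p⁻² − p⁻³) ≤ 2^{ω(d)} d⁻¹` for squarefree `d`. [folklore] -/
theorem resFactor1Div_le {d : ℕ} (hd : Squarefree d) :
    resFactor1Div d ≤ (2 : ℝ) ^ d.primeFactors.card * (d : ℝ) ^ (-1 : ℝ) := by
  rw [rpow_of_squarefree hd _, resFactor1Div, Finset.pow_card_mul_prod]
  refine Finset.prod_le_prod (fun p hp => ?_) fun p hp => (rpow_neg_one_le_factor1Div (Nat.prime_of_mem_primeFactors hp)).2
  exact le_trans (Real.rpow_nonneg (by positivity) _) (rpow_neg_one_le_factor1Div (Nat.prime_of_mem_primeFactors hp)).1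

/-- `|∏_{p∣d}(p⁻¹ + p^{-4/3} − p^{-7/3})| ≤ 2^{ω(d)} d⁻¹` for squarefree `d`. [folklore] -/
theorem abs_resFactor56Div_le {d : ℕ} (hd : Squarefree d) :
    |resFactor56Div d| ≤ (2 : ℝ) ^ d.primeFactors.card * (d : ℝ) ^ (-1 : ℝ) := by
  rw [rpow_of_squarefree hd _, resFactor56Div, Finset.abs_prod, Finset.pow_card_mul_prod]
  refine Finset.prod_le_prod (fun p _ => abs_nonneg _) fun p hp => ?_
  have hpr := Nat.prime_of_mem_primeFactors hp
  obtain ⟨h1, h2⟩ := rpow_neg_one_le_factor56Div hpr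
  rw [abs_of_nonneg (le_trans (Real.rpow_nonneg (by positivity) _) h1)]
  exact h2

/-! ### Theorem 2.4 for `Φ_{d,m}` as a hypothesis schema -/

/-- **The content of Bhargava–Taniguchi–Thorne 2023, Theorem 2.4 with (13), (14), for `Φ_{d,m} = 𝟙_{m²d ∣ Disc}`**
(coprime squarefree `d, m`), at one sign — a HYPOTHESIS SCHEMA (a `Prop`-valued structure with parameters; the final
assembly consumes `∀ d m …, ∀ sgn = ±1, HasDivResidues d m sgn`; nothing is asserted): "the Shintani zeta functions
`ξ^±(s, Φ_m)` converge absolutely for `Re(s) > 1`, have analytic continuation to all of `ℂ`, holomorphic except for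
simple poles at `s = 1` and `s = 5/6`" (`exists_entire`: `(s − 1)(s − 5/6) ξ^±(s, Φ)` extends to an entire function),
"the residues are given by `Res_{s=1} ξ^± (s, Φ_m) = α^± 𝒜(Φ_m) + β ℬ(Φ_m)` and `Res_{s=5/6} ξ^±(s, Φ_m) = γ^± 𝒞(Φ_m)`
… and for functions of the form `Φ_m = ⊗_{p^a ∥ m} Φ_{p^a}` we have `𝒜(Φ_m) = ∏ 𝒜(Φ_{p^a})`" etc. (14), with, "for the
characteristic function `Φ_{p²}` of those `x` with `p² ∣ Disc(x)`: `𝒜(Φ_{p²}) = ℬ(Φ_{p²}) = 2p⁻² − p⁻⁴`,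
`𝒞(Φ_{p²}) = p^{-5/3} + 2p⁻² − p^{-8/3} − p⁻³`" and "for the characteristic function `Φ_p` of those `x` with
`p ∣ Disc(x)`: `𝒜(Φ_p) = ℬ(Φ_p) = p⁻¹ + p⁻² − p⁻³`, `𝒞(Φ_p) = p⁻¹ + p^{-4/3} − p^{-7/3}`". So
`Res_{s=1} = (α^± + β) ∏_{p∣d}(p⁻¹ + p⁻² − p⁻³) ∏_{p∣m}(2p⁻² − p⁻⁴)` (`shintaniRes1_eq`, with `resFactor1 m` of
`ShintaniZetaResidues.lean`) and `Res_{s=5/6} = γ^± ∏_{p∣d}(p⁻¹ + p^{-4/3} − p^{-7/3}) ∏_{p∣m}(p^{-5/3} + 2p⁻² − p^{-8/3} − p⁻³)`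
(`shintaniRes56_eq`). (The Sato–Shintani theory behind Theorem 2.4 — Shintani 1972, Datskovsky–Wright 1986, F. Sato 1989,
Taniguchi–Thorne *Orbital L-functions* §§4–8, Props. 8.14, 8.15 — is not in Mathlib.)
[cite: BhargavaTaniguchiThorne2023, Thm 2.4 with (13), (14) (cases Φ_p of p ∣ Disc and Φ_{p²} of p² ∣ Disc)] -/
structure HasDivResidues (d m : ℕ) (sgn : ℤ) : Prop where
  /-- analytic continuation with at most simple poles at `1` and `5/6` -/
  exists_entire : ∃ Λ : ℂ → ℂ, IsShintaniEntire (divIndicator d m) sgn Λ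
  /-- (13) + (14) + the two displayed cases, at `s = 1` -/
  shintaniRes1_eq : shintaniRes1 (divIndicator d m) sgn =
    (((shintaniAlpha sgn + shintaniBeta) * (resFactor1Div d * resFactor1 m) : ℝ) : ℂ)
  /-- (13) + (14) + the two displayed cases, at `s = 5/6` -/
  shintaniRes56_eq : shintaniRes56 (divIndicator d m) sgn =
    ((shintaniGamma sgn * (resFactor56Div d * resFactor56 m) : ℝ) : ℂ)

namespace HasDivResidues

variable {d m : ℕ} {sgn : ℤ}

/-- The residue at `1` is real. [folklore] -/
theorem re_shintaniRes1 (h : HasDivResidues d m sgn) :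
    (shintaniRes1 (divIndicator d m) sgn).re = (shintaniAlpha sgn + shintaniBeta) * (resFactor1Div d * resFactor1 m) := by
  rw [h.shintaniRes1_eq, Complex.ofReal_re]

/-- `‖Res₁‖ = Res₁` (a positive real). [folklore] -/
theorem norm_shintaniRes1 (h : HasDivResidues d m sgn) :
    ‖shintaniRes1 (divIndicator d m) sgn‖ = (shintaniAlpha sgn + shintaniBeta) * (resFactor1Div d * resFactor1 m) := by
  rw [h.shintaniRes1_eq, Complex.norm_real, Real.norm_eq_abs, abs_of_pos]
  exact mul_pos (add_pos (shintaniAlpha_pos sgn) shintaniBeta_pos) (mul_pos (resFactor1Div_pos d) (resFactor1_pos m))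

/-- `‖Res_{5/6}‖ = |γ| |𝒞(Φ_d)| |𝒞(Φ_{m²})|`. [folklore] -/
theorem norm_shintaniRes56 (h : HasDivResidues d m sgn) :
    ‖shintaniRes56 (divIndicator d m) sgn‖ = |shintaniGamma sgn| * (|resFactor56Div d| * |resFactor56 m|) := by
  rw [h.shintaniRes56_eq, Complex.norm_real, Real.norm_eq_abs, abs_mul, abs_mul]

end HasDivResidues

/-! ### From Shintani-weighted counts to orbit counts -/

/-- Reindexing `n ↦ s·n`: `Σ_{1 ≤ n < N} g(s n) = Σ_{D ∈ discWindow s N} g(D)`. [folklore] -/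
theorem sum_Ico_eq_sum_discWindow {s : ℤ} (hs : s = 1 ∨ s = -1) (N : ℕ) (g : ℤ → ℝ) :
    ∑ n ∈ Finset.Ico 1 N, g (s * n) = ∑ D ∈ discWindow s N, g D := by
  symm
  refine Finset.sum_bij' (fun D _ => (s * D).toNat) (fun n _ => s * (n : ℤ)) ?_ ?_ ?_ ?_ ?_
  · intro D hD
    have h := (mem_discWindow hs).mp hD
    rw [Finset.mem_Ico]
    have h1 : ((s * D).toNat : ℤ) = s * D := Int.toNat_of_nonneg h.1.le
    constructor
    · have : (1 : ℤ) ≤ (s * D).toNat := by rw [h1]; exact h.1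
      exact_mod_cast this
    · have : ((s * D).toNat : ℤ) < N := by rw [h1]; exact_mod_cast h.2
      exact_mod_cast this
  · intro n hn
    rw [Finset.mem_Ico] at hn
    rw [mem_discWindow hs]
    have hss : s * (s * (n : ℤ)) = n := by rcases hs with rfl | rfl <;> ring
    rw [hss]
    exact ⟨by exact_mod_cast hn.1, by exact_mod_cast hn.2⟩
  · intro D hD
    have h := (mem_discWindow hs).mp hD
    rw [Int.toNat_of_nonneg h.1.le]
    rcases hs with rfl | rfl <;> ring
  · intro n hn
    have hss : s * (s * (n : ℤ)) = n := by rcases hs with rfl | rfl <;> ring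
    rw [hss, Int.toNat_natCast]
  · intro D hD
    have h := (mem_discWindow hs).mp hD
    have hsD : (s * ((s * D).toNat : ℤ) : ℤ) = D := by
      rw [Int.toNat_of_nonneg h.1.le]
      rcases hs with rfl | rfl <;> ring
    rw [hsD]

/-- **`h(D) ≤ 12 · a(Φ, D)` when `Φ ≡ 1` on the forms of discriminant `D ≠ 0`** (every weight `1/|Stab| ≥ 1/12`).
[folklore] -/
theorem classNumber_le_twelve_mul_re_coeff {M : ℕ} (Φ : BinaryCubic (ZMod M) → ℂ) {D : ℤ} (hD : D ≠ 0)
    (hone : ∀ f : BinaryCubic ℤ, f.disc = D → Φ (f.map (Int.castRingHom (ZMod M))) = 1) :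
    (classNumber D : ℝ) ≤ 12 * (shintaniCoeffWith (fun f => Φ (f.map (Int.castRingHom (ZMod M)))) D).re := by
  haveI := finite_orbitsOfDisc hD
  haveI : Fintype (orbitsOfDisc D) := Fintype.ofFinite _
  unfold shintaniCoeffWith
  rw [finsum_eq_sum_of_fintype, Complex.re_sum, Finset.mul_sum, classNumber, Nat.card_eq_fintype_card]
  have hcard : (Fintype.card (orbitsOfDisc D) : ℝ) = ∑ _O : orbitsOfDisc D, (1 : ℝ) := by simp
  rw [hcard]
  refine Finset.sum_le_sum fun O _ => ?_
  dsimp only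
  have hdisc : (orbitRep O).disc = D := (orbitRep_spec O).2
  have h0 : (orbitRep O).disc ≠ 0 := by rw [hdisc]; exact hD
  have hst : (stabCard (orbitRep O) : ℝ) ≤ 12 := by exact_mod_cast stabCard_le_twelve h0
  have hst0 : (0 : ℝ) < stabCard (orbitRep O) := stabCard_pos h0
  rw [hone _ hdisc]
  have hre : ((1 : ℂ) / (stabCard (orbitRep O) : ℂ)).re = 1 / (stabCard (orbitRep O) : ℝ) := by
    rw [show ((stabCard (orbitRep O) : ℕ) : ℂ) = ((stabCard (orbitRep O) : ℝ) : ℂ) by norm_cast, ← Complex.ofReal_one,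
      ← Complex.ofReal_div, Complex.ofReal_re]
  rw [hre, mul_one_div]
  exact (one_le_div hst0).mpr hst

/-- **The orbit count is at most `12 · N^{sgn}(Y, Φ_{d,m})`**: the orbits with `0 < α Disc < Y`, `m² ∣ Disc`, `d ∣ Disc`
(`m, d` coprime) have `Φ_{d,m} = 1`, and each carries Shintani weight `≥ 1/12`.
[cite: BhargavaTaniguchiThorne2023, §2.4 (11)–(12), §5 (N > Q^{100}: counting via N(Y, Φ))] -/
theorem ncard_divFam_le_re_partialSum {α : ℤ} (hα : α = 1 ∨ α = -1) {m d : ℕ} (hmd : m.Coprime d) (Y : ℝ) :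
    ((divFam α Y m d ∅ ∅).ncard : ℝ) ≤ 12 * (shintaniPartialSum (divIndicator d m) α Y).re := by
  set M : ℕ := m ^ 2 * d with hM
  set N : ℕ := ⌈Y⌉₊ with hN
  set F : Finset ℤ := (discWindow α N).filter (fun D => (M : ℤ) ∣ D) with hF
  have hF0 : ∀ D ∈ F, D ≠ 0 := by
    intro D hD h0
    have h := ((mem_discWindow hα).mp (Finset.mem_filter.mp hD).1).1
    rw [h0, mul_zero] at h
    exact lt_irrefl _ h
  -- the family sits inside the union of the orbit sets of the admissible discriminants
  have hsub : divFam α Y m d ∅ ∅ ⊆ ⋃ D ∈ F, orbitsOfDisc D := by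
    rintro O ⟨f, hO, ⟨h0, hlt⟩, hm2, hdd, -, -⟩
    refine Set.mem_iUnion₂.mpr ⟨f.disc, ?_, f, hO, rfl⟩
    rw [hF, Finset.mem_filter, mem_discWindow hα]
    refine ⟨⟨h0, ?_⟩, ?_⟩
    · have h1 : ((α * f.disc : ℤ) : ℝ) < (N : ℝ) := hlt.trans_le (Nat.le_ceil Y)
      exact_mod_cast h1
    · rw [hM]
      push_cast
      have hcop : IsCoprime ((m : ℤ) ^ 2) (d : ℤ) := by
        rw [show ((m : ℤ) ^ 2) = ((m ^ 2 : ℕ) : ℤ) by push_cast; ring, Nat.isCoprime_iff_coprime]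
        exact Nat.Coprime.pow_left 2 hmd
      exact hcop.mul_dvd hm2 hdd
  have hfin : (⋃ D ∈ F, orbitsOfDisc D).Finite :=
    Set.Finite.biUnion (Finset.finite_toSet F) fun D hD => (finite_orbitsOfDisc (hF0 D hD))
  -- the weight is `1` on these discriminants
  have hone : ∀ D ∈ F, ∀ f : BinaryCubic ℤ, f.disc = D → divIndicator d m (f.map (Int.castRingHom (ZMod (m ^ 2 * d)))) = 1 := by
    intro D hD f hf
    refine divIndicator_map_eq_one ?_
    rw [hf, ← hM]
    exact (Finset.mem_filter.mp hD).2
  have hnn : ∀ D : ℤ, 0 ≤ (shintaniCoeffWith (fun f => divIndicator d m (f.map (Int.castRingHom (ZMod (m ^ 2 * d))))) D).re :=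
    fun D => (shintaniCoeffWith_re_nonneg (fun f => divIndicator_nonneg d m _) D).1
  calc ((divFam α Y m d ∅ ∅).ncard : ℝ) ≤ ((⋃ D ∈ F, orbitsOfDisc D).ncard : ℝ) := by
        exact_mod_cast Set.ncard_le_ncard hsub hfin
    _ = ((∑ D ∈ F, classNumber D : ℕ) : ℝ) := by rw [ncard_biUnion_orbitsOfDisc F hF0]
    _ = ∑ D ∈ F, (classNumber D : ℝ) := by push_cast; rfl
    _ ≤ ∑ D ∈ F, 12 * (shintaniCoeffWith (fun f => divIndicator d m (f.map (Int.castRingHom (ZMod (m ^ 2 * d))))) D).re :=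
        Finset.sum_le_sum fun D hD => classNumber_le_twelve_mul_re_coeff _ (hF0 D hD) (hone D hD)
    _ ≤ ∑ D ∈ discWindow α N, 12 * (shintaniCoeffWith (fun f => divIndicator d m (f.map (Int.castRingHom (ZMod (m ^ 2 * d))))) D).re :=
        Finset.sum_le_sum_of_subset_of_nonneg (Finset.filter_subset _ _) fun D _ _ => mul_nonneg (by norm_num) (hnn D)
    _ = 12 * ∑ n ∈ Finset.Ico 1 N, (shintaniCoeffMod (divIndicator d m) α n).re := by
        rw [Finset.mul_sum]
        exact (sum_Ico_eq_sum_discWindow hα N (fun D => 12 *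
          (shintaniCoeffWith (fun f => divIndicator d m (f.map (Int.castRingHom (ZMod (m ^ 2 * d))))) D).re)).symm
    _ = 12 * (shintaniPartialSum (divIndicator d m) α Y).re := by
        rw [shintaniPartialSum, Complex.re_sum]

/-! ### A uniform bound for the dual density -/

/-- **`δ̂₁(Φ) ≤ M⁴ · 2 B C`** for `|Φ| ≤ B` on `V(ℤ/Mℤ)`, where `Σ_{D ∈ window X} h(D) ≤ C X` (Prop. 4.5 at `q = 1`):
the explicit form of `dualDensity_le`. [folklore] -/
theorem dualDensity_le_explicit {C : ℝ}
    (hC : ∀ s : ℤ, (s = 1 ∨ s = -1) → ∀ X : ℕ, ∑ D ∈ discWindow s X, (classNumber D : ℝ) ≤ C * X)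
    {M : ℕ} [NeZero M] {Φ : BinaryCubic (ZMod M) → ℂ} {B : ℝ} (hB : 0 ≤ B) (hΦ : ∀ y, ‖Φ y‖ ≤ B) :
    dualDensity Φ ≤ (M : ℝ) ^ 4 * (2 * B * C) := by
  have hC0 : 0 ≤ C := by
    have h := hC 1 (Or.inl rfl) 1
    have h0 : 0 ≤ ∑ D ∈ discWindow 1 1, (classNumber D : ℝ) := Finset.sum_nonneg fun _ _ => Nat.cast_nonneg _
    simpa using h0.trans h
  have hpd : ∀ N : ℕ, dualPartialDensity Φ N ≤ 2 * B * C := by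
    intro N
    rcases Nat.eq_zero_or_pos N with rfl | hN
    · simp only [dualPartialDensity, Nat.cast_zero, inv_zero, zero_mul]; positivity
    have hsum : ∀ {α : ℤ}, (α = 1 ∨ α = -1) →
        ∑ n ∈ Finset.Ico 1 N, (dualAbsCoeff Φ α n).re ≤ B * (C * N) := by
      intro α hα
      calc ∑ n ∈ Finset.Ico 1 N, (dualAbsCoeff Φ α n).re
          ≤ ∑ n ∈ Finset.Ico 1 N, B * (classNumber (α * n) : ℝ) := Finset.sum_le_sum fun n hn =>
            dualAbsCoeff_re_le hB hΦ hα (by have := (Finset.mem_Ico.mp hn).1; omega)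
        _ = B * ∑ D ∈ discWindow α N, (classNumber D : ℝ) := by
            rw [← Finset.mul_sum, sum_Ico_eq_sum_discWindow hα N (fun D => (classNumber D : ℝ))]
        _ ≤ B * (C * N) := mul_le_mul_of_nonneg_left (hC α hα N) hB
    have hN0 : (0 : ℝ) < N := by exact_mod_cast hN
    unfold dualPartialDensity
    rw [Finset.sum_add_distrib]
    calc (N : ℝ)⁻¹ * (∑ n ∈ Finset.Ico 1 N, (dualAbsCoeff Φ 1 n).re + ∑ n ∈ Finset.Ico 1 N, (dualAbsCoeff Φ (-1) n).re)
        ≤ (N : ℝ)⁻¹ * (B * (C * N) + B * (C * N)) :=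
          mul_le_mul_of_nonneg_left (add_le_add (hsum (Or.inl rfl)) (hsum (Or.inr rfl))) (by positivity)
      _ = 2 * B * C := by field_simp; ring
  rw [dualDensity_eq]
  exact mul_le_mul_of_nonneg_left (ciSup_le hpd) (by positivity)

/-! ### The residues of `Φ_{d,m}`: size -/

/-- `b^{ω(n)} ≤ n^θ` when `b ≤ p^θ` for every prime `p ∣ n` (`n` squarefree). [folklore] -/
theorem pow_card_primeFactors_le_rpow_of_forall {n : ℕ} (hn : Squarefree n) {b θ : ℝ} (hb : 0 ≤ b)
    (h : ∀ p ∈ n.primeFactors, b ≤ (p : ℝ) ^ θ) : b ^ n.primeFactors.card ≤ (n : ℝ) ^ θ := by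
  rw [rpow_of_squarefree hn, ← Finset.prod_const]
  exact Finset.prod_le_prod (fun _ _ => hb) h

/-- `2 ≤ p^{5/6}` and `4 ≤ p^{4/3}` for a prime `p ≥ 5` (`2⁶ ≤ 5⁵`, `4³ ≤ 5⁴`). [folklore] -/
theorem two_le_rpow_of_five_le {p : ℕ} (hp : 5 ≤ p) :
    (2 : ℝ) ≤ (p : ℝ) ^ ((5 : ℝ) / 6) ∧ (4 : ℝ) ≤ (p : ℝ) ^ ((4 : ℝ) / 3) := by
  have hp5 : (5 : ℝ) ≤ p := by exact_mod_cast hp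
  have hp0 : (0 : ℝ) ≤ p := by linarith
  constructor
  · have h6 : ((p : ℝ) ^ ((5 : ℝ) / 6)) ^ (6 : ℕ) = (p : ℝ) ^ (5 : ℕ) := by
      rw [← Real.rpow_natCast ((p : ℝ) ^ ((5 : ℝ) / 6)) 6, ← Real.rpow_mul hp0, ← Real.rpow_natCast (p : ℝ) 5]
      norm_num
    rw [← pow_le_pow_iff_left₀ (by norm_num) (Real.rpow_nonneg hp0 _) (by norm_num : (6 : ℕ) ≠ 0), h6]
    calc (2 : ℝ) ^ (6 : ℕ) ≤ 5 ^ (5 : ℕ) := by norm_num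
      _ ≤ (p : ℝ) ^ (5 : ℕ) := pow_le_pow_left₀ (by norm_num) hp5 5
  · have h3 : ((p : ℝ) ^ ((4 : ℝ) / 3)) ^ (3 : ℕ) = (p : ℝ) ^ (4 : ℕ) := by
      rw [← Real.rpow_natCast ((p : ℝ) ^ ((4 : ℝ) / 3)) 3, ← Real.rpow_mul hp0, ← Real.rpow_natCast (p : ℝ) 4]
      norm_num
    rw [← pow_le_pow_iff_left₀ (by norm_num) (Real.rpow_nonneg hp0 _) (by norm_num : (3 : ℕ) ≠ 0), h3]
    calc (4 : ℝ) ^ (3 : ℕ) ≤ 5 ^ (4 : ℕ) := by norm_num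
      _ ≤ (p : ℝ) ^ (4 : ℕ) := pow_le_pow_left₀ (by norm_num) hp5 4

/-- The prime factors of a number prime to `6` are `≥ 5`. [folklore] -/
theorem five_le_of_mem_primeFactors_of_coprime_six {n p : ℕ} (h6 : n.Coprime 6) (hp : p ∈ n.primeFactors) : 5 ≤ p := by
  have hpr := Nat.prime_of_mem_primeFactors hp
  have hpn := Nat.dvd_of_mem_primeFactors hp
  have h2 : p ≠ 2 := fun h => by
    have : (2 : ℕ) ∣ Nat.gcd n 6 := Nat.dvd_gcd (h ▸ hpn) (by norm_num)
    rw [h6] at this; omega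
  have h3 : p ≠ 3 := fun h => by
    have : (3 : ℕ) ∣ Nat.gcd n 6 := Nat.dvd_gcd (h ▸ hpn) (by norm_num)
    rw [h6] at this; omega
  have := hpr.two_le
  by_contra hlt
  push Not at hlt
  interval_cases p
  · exact h2 rfl
  · exact h3 rfl
  · exact absurd hpr (by decide)

/-- `2^{ω(n)} ≤ n^{5/6}` and `4^{ω(n)} ≤ n^{4/3}` for squarefree `n` prime to `6`. [folklore] -/
theorem pow_card_primeFactors_le_of_coprime_six {n : ℕ} (hn : Squarefree n) (h6 : n.Coprime 6) :
    (2 : ℝ) ^ n.primeFactors.card ≤ (n : ℝ) ^ ((5 : ℝ) / 6) ∧ (4 : ℝ) ^ n.primeFactors.card ≤ (n : ℝ) ^ ((4 : ℝ) / 3) :=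
  ⟨pow_card_primeFactors_le_rpow_of_forall hn (by norm_num) fun p hp =>
      (two_le_rpow_of_five_le (five_le_of_mem_primeFactors_of_coprime_six h6 hp)).1,
    pow_card_primeFactors_le_rpow_of_forall hn (by norm_num) fun p hp =>
      (two_le_rpow_of_five_le (five_le_of_mem_primeFactors_of_coprime_six h6 hp)).2⟩

/-- `Γ := |γ⁺| + |γ⁻|` dominates `|γ^{sgn}|`. [folklore] -/
theorem abs_shintaniGamma_le (sgn : ℤ) (hs : sgn = 1 ∨ sgn = -1) :
    |shintaniGamma sgn| ≤ |shintaniGamma 1| + |shintaniGamma (-1)| := by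
  rcases hs with rfl | rfl
  · linarith [abs_nonneg (shintaniGamma (-1))]
  · linarith [abs_nonneg (shintaniGamma 1)]

/-- `α^{sgn} ≤ α⁻ = π²/24`. [folklore] -/
theorem shintaniAlpha_le (sgn : ℤ) : shintaniAlpha sgn ≤ shintaniAlpha (-1) := by
  rw [shintaniAlpha_neg_one]
  unfold shintaniAlpha
  split_ifs
  · have h := sq_nonneg Real.pi
    rw [sq] at h
    have : Real.pi ^ 2 = Real.pi * Real.pi := sq Real.pi
    rw [this]
    linarith
  · exact le_rfl

variable {d m : ℕ} {sgn : ℤ}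

/-- **Lower bound `Res₁ ≥ β/(m² d)`** (`α + β ≥ β`, `𝒜(Φ_d) ≥ d⁻¹`, `𝒜(Φ_{m²}) ≥ m⁻²`). [folklore] -/
theorem HasDivResidues.lower (h : HasDivResidues d m sgn) (hd : Squarefree d) (hm : Squarefree m) :
    shintaniBeta / ((m : ℝ) ^ 2 * d) ≤ (shintaniRes1 (divIndicator d m) sgn).re := by
  rw [h.re_shintaniRes1]
  have hd0 : (0 : ℝ) < d := by exact_mod_cast Nat.pos_of_ne_zero hd.ne_zero
  have hm0 : (0 : ℝ) < m := by exact_mod_cast Nat.pos_of_ne_zero hm.ne_zero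
  have h1 : (d : ℝ)⁻¹ ≤ resFactor1Div d := by
    have := rpow_neg_one_le_resFactor1Div hd; rwa [Real.rpow_neg_one] at this
  have h2 : ((m : ℝ) ^ 2)⁻¹ ≤ resFactor1 m := by
    have := rpow_neg_two_le_resFactor1 hm
    rwa [Real.rpow_neg hm0.le, Real.rpow_two] at this
  have hab : shintaniBeta ≤ shintaniAlpha sgn + shintaniBeta := le_add_of_nonneg_left (shintaniAlpha_pos sgn).le
  calc shintaniBeta / ((m : ℝ) ^ 2 * d) = shintaniBeta * ((d : ℝ)⁻¹ * ((m : ℝ) ^ 2)⁻¹) := by field_simp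
    _ ≤ (shintaniAlpha sgn + shintaniBeta) * (resFactor1Div d * resFactor1 m) :=
        mul_le_mul hab (mul_le_mul h1 h2 (by positivity) (resFactor1Div_pos d).le) (by positivity)
          (add_pos (shintaniAlpha_pos sgn) shintaniBeta_pos).le

/-- **Upper bound `Res₁ ≤ (α⁻ + β) 2^{ω(md)}/(m² d)`**. [folklore] -/
theorem HasDivResidues.upper (h : HasDivResidues d m sgn) (hd : Squarefree d) (hm : Squarefree m) (hmd : m.Coprime d) :
    (shintaniRes1 (divIndicator d m) sgn).re ≤
      (shintaniAlpha (-1) + shintaniBeta) * 2 ^ (m * d).primeFactors.card / ((m : ℝ) ^ 2 * d) := by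
  rw [h.re_shintaniRes1]
  have hd0 : (0 : ℝ) < d := by exact_mod_cast Nat.pos_of_ne_zero hd.ne_zero
  have hm0 : (0 : ℝ) < m := by exact_mod_cast Nat.pos_of_ne_zero hm.ne_zero
  have h1 : resFactor1Div d ≤ 2 ^ d.primeFactors.card * (d : ℝ)⁻¹ := by
    have := resFactor1Div_le hd; rwa [Real.rpow_neg_one] at this
  have h2 : resFactor1 m ≤ 2 ^ m.primeFactors.card * ((m : ℝ) ^ 2)⁻¹ := by
    have := resFactor1_le hm; rwa [Real.rpow_neg hm0.le, Real.rpow_two] at this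
  have hω : (m * d).primeFactors.card = m.primeFactors.card + d.primeFactors.card := by
    rw [Nat.Coprime.primeFactors_mul hmd, Finset.card_union_of_disjoint (Nat.Coprime.disjoint_primeFactors hmd)]
  have hab : shintaniAlpha sgn + shintaniBeta ≤ shintaniAlpha (-1) + shintaniBeta :=
    add_le_add (shintaniAlpha_le sgn) le_rfl
  calc (shintaniAlpha sgn + shintaniBeta) * (resFactor1Div d * resFactor1 m)
      ≤ (shintaniAlpha (-1) + shintaniBeta) * ((2 ^ d.primeFactors.card * (d : ℝ)⁻¹) * (2 ^ m.primeFactors.card * ((m : ℝ) ^ 2)⁻¹)) :=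
        mul_le_mul hab (mul_le_mul h1 h2 (resFactor1_pos m).le (by positivity))
          (mul_pos (resFactor1Div_pos d) (resFactor1_pos m)).le (add_pos (shintaniAlpha_pos (-1)) shintaniBeta_pos).le
    _ = (shintaniAlpha (-1) + shintaniBeta) * 2 ^ (m * d).primeFactors.card / ((m : ℝ) ^ 2 * d) := by
        rw [hω, pow_add]; field_simp

/-- **`‖Res_{5/6}‖ ≤ Γ d^{-1/6} m^{-1/3}`** for `d, m` squarefree prime to `6` (`2^{ω(d)} ≤ d^{5/6}`, `4^{ω(m)} ≤ m^{4/3}`). [folklore] -/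
theorem HasDivResidues.norm_res56_le (h : HasDivResidues d m sgn) (hs : sgn = 1 ∨ sgn = -1) (hd : Squarefree d)
    (hm : Squarefree m) (hd6 : d.Coprime 6) (hm6 : m.Coprime 6) :
    ‖shintaniRes56 (divIndicator d m) sgn‖ ≤
      (|shintaniGamma 1| + |shintaniGamma (-1)|) * ((d : ℝ) ^ (-(1 : ℝ) / 6) * (m : ℝ) ^ (-(1 : ℝ) / 3)) := by
  rw [h.norm_shintaniRes56]
  have hd0 : (0 : ℝ) < d := by exact_mod_cast Nat.pos_of_ne_zero hd.ne_zero
  have hm0 : (0 : ℝ) < m := by exact_mod_cast Nat.pos_of_ne_zero hm.ne_zero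
  have h2d := (pow_card_primeFactors_le_of_coprime_six hd hd6).1
  have h4m := (pow_card_primeFactors_le_of_coprime_six hm hm6).2
  have hF : |resFactor56Div d| ≤ (d : ℝ) ^ (-(1 : ℝ) / 6) := by
    refine (abs_resFactor56Div_le hd).trans ?_
    calc (2 : ℝ) ^ d.primeFactors.card * (d : ℝ) ^ (-1 : ℝ) ≤ (d : ℝ) ^ ((5 : ℝ) / 6) * (d : ℝ) ^ (-1 : ℝ) :=
          mul_le_mul_of_nonneg_right h2d (Real.rpow_nonneg hd0.le _)
      _ = (d : ℝ) ^ (-(1 : ℝ) / 6) := by rw [← Real.rpow_add hd0]; norm_num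
  have hG : |resFactor56 m| ≤ (m : ℝ) ^ (-(1 : ℝ) / 3) := by
    refine (abs_resFactor56_le hm).trans ?_
    calc (4 : ℝ) ^ m.primeFactors.card * (m : ℝ) ^ (-(5 : ℝ) / 3) ≤ (m : ℝ) ^ ((4 : ℝ) / 3) * (m : ℝ) ^ (-(5 : ℝ) / 3) :=
          mul_le_mul_of_nonneg_right h4m (Real.rpow_nonneg hm0.le _)
      _ = (m : ℝ) ^ (-(1 : ℝ) / 3) := by rw [← Real.rpow_add hm0]; norm_num
  exact mul_le_mul (abs_shintaniGamma_le sgn hs) (mul_le_mul hF hG (abs_nonneg _) (Real.rpow_nonneg hd0.le _))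
    (by positivity) (by positivity)

/-- **Hypothesis (16) for `Φ_{d,m}` at heights `Y ≥ (m²d)⁵`**: `‖Res_{5/6}‖ ≤ (Γ/β + 1) Y^{1/6} ‖Res₁‖`. [folklore] -/
theorem HasDivResidues.hyp16 (h : HasDivResidues d m sgn) (hs : sgn = 1 ∨ sgn = -1) (hd : Squarefree d)
    (hm : Squarefree m) (hd6 : d.Coprime 6) (hm6 : m.Coprime 6) {Y : ℝ} (hY : ((m : ℝ) ^ 2 * d) ^ 5 ≤ Y) :
    ‖shintaniRes56 (divIndicator d m) sgn‖ ≤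
      ((|shintaniGamma 1| + |shintaniGamma (-1)|) / shintaniBeta + 1) * Y ^ ((1 : ℝ) / 6) *
        ‖shintaniRes1 (divIndicator d m) sgn‖ := by
  have hd0 : (0 : ℝ) < d := by exact_mod_cast Nat.pos_of_ne_zero hd.ne_zero
  have hm0 : (0 : ℝ) < m := by exact_mod_cast Nat.pos_of_ne_zero hm.ne_zero
  have hβ := shintaniBeta_pos
  set Γ : ℝ := |shintaniGamma 1| + |shintaniGamma (-1)| with hΓ
  have hΓ0 : 0 ≤ Γ := by positivity
  have hM0 : (0 : ℝ) < (m : ℝ) ^ 2 * d := by positivity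
  have hY0 : 0 < Y := lt_of_lt_of_le (by positivity) hY
  -- `Y^{1/6} ≥ (m²d)^{5/6} = m^{5/3} d^{5/6}`
  have hY6 : (m : ℝ) ^ ((5 : ℝ) / 3) * (d : ℝ) ^ ((5 : ℝ) / 6) ≤ Y ^ ((1 : ℝ) / 6) := by
    have h1 : (((m : ℝ) ^ 2 * d) ^ 5) ^ ((1 : ℝ) / 6) ≤ Y ^ ((1 : ℝ) / 6) := Real.rpow_le_rpow (by positivity) hY (by norm_num)
    refine le_of_eq_of_le ?_ h1
    rw [← Real.rpow_natCast ((m : ℝ) ^ 2 * d) 5, ← Real.rpow_mul hM0.le, Real.mul_rpow (by positivity) hd0.le,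
      ← Real.rpow_natCast (m : ℝ) 2, ← Real.rpow_mul hm0.le]
    norm_num
  -- `‖Res₁‖ ≥ β d⁻¹ m⁻²`
  have hR : shintaniBeta / ((m : ℝ) ^ 2 * d) ≤ ‖shintaniRes1 (divIndicator d m) sgn‖ := by
    rw [h.norm_shintaniRes1, ← h.re_shintaniRes1]; exact h.lower hd hm
  calc ‖shintaniRes56 (divIndicator d m) sgn‖ ≤ Γ * ((d : ℝ) ^ (-(1 : ℝ) / 6) * (m : ℝ) ^ (-(1 : ℝ) / 3)) :=
        h.norm_res56_le hs hd hm hd6 hm6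
    _ = Γ * ((m : ℝ) ^ ((5 : ℝ) / 3) * (d : ℝ) ^ ((5 : ℝ) / 6)) * (1 / ((m : ℝ) ^ 2 * d)) := by
        have e1 : (m : ℝ) ^ ((5 : ℝ) / 3) = (m : ℝ) ^ (-(1 : ℝ) / 3) * (m : ℝ) ^ 2 := by
          rw [show (m : ℝ) ^ 2 = (m : ℝ) ^ (2 : ℝ) by rw [Real.rpow_two], ← Real.rpow_add hm0]; norm_num
        have e2 : (d : ℝ) ^ ((5 : ℝ) / 6) = (d : ℝ) ^ (-(1 : ℝ) / 6) * d := by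
          conv_rhs => rw [show (d : ℝ) ^ (-(1 : ℝ) / 6) * d = (d : ℝ) ^ (-(1 : ℝ) / 6) * (d : ℝ) ^ (1 : ℝ) by
            rw [Real.rpow_one]]
          rw [← Real.rpow_add hd0]; norm_num
        rw [e1, e2]
        field_simp
    _ ≤ Γ * Y ^ ((1 : ℝ) / 6) * (1 / ((m : ℝ) ^ 2 * d)) := by
        refine mul_le_mul_of_nonneg_right (mul_le_mul_of_nonneg_left hY6 hΓ0) (by positivity)
    _ = (Γ / shintaniBeta) * Y ^ ((1 : ℝ) / 6) * (shintaniBeta / ((m : ℝ) ^ 2 * d)) := by field_simp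
    _ ≤ (Γ / shintaniBeta + 1) * Y ^ ((1 : ℝ) / 6) * ‖shintaniRes1 (divIndicator d m) sgn‖ := by
        refine mul_le_mul (mul_le_mul_of_nonneg_right (by linarith) (Real.rpow_nonneg hY0.le _)) hR (by positivity)
          (by positivity)


/-! ### The count: Theorem 3.2 for the one-member family `{(Φ_{d,m}, Y)}` -/

/-- The `rpow` algebra of the error term: `Y^{3/5} R^{3/5} (Y R)^{2/5} = Y R`. [folklore] -/
theorem rpow_three_fifths_mul {Y R : ℝ} (hY : 0 ≤ Y) (hR : 0 ≤ R) :
    Y ^ ((3 : ℝ) / 5) * R ^ ((3 : ℝ) / 5) * (Y * R) ^ ((2 : ℝ) / 5) = Y * R := by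
  rw [Real.mul_rpow hY hR]
  have hY' : Y ^ ((3 : ℝ) / 5) * Y ^ ((2 : ℝ) / 5) = Y := by
    rw [← Real.rpow_add' hY (by norm_num)]; norm_num
  have hR' : R ^ ((3 : ℝ) / 5) * R ^ ((2 : ℝ) / 5) = R := by
    rw [← Real.rpow_add' hR (by norm_num)]; norm_num
  calc Y ^ ((3 : ℝ) / 5) * R ^ ((3 : ℝ) / 5) * (Y ^ ((2 : ℝ) / 5) * R ^ ((2 : ℝ) / 5))
      = (Y ^ ((3 : ℝ) / 5) * Y ^ ((2 : ℝ) / 5)) * (R ^ ((3 : ℝ) / 5) * R ^ ((2 : ℝ) / 5)) := by ring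
    _ = Y * R := by rw [hY', hR']

/-- `Y^{1/6} · Y^{5/6} = Y`. [folklore] -/
theorem rpow_sixth_mul_rpow_five_sixths {Y : ℝ} (hY : 0 ≤ Y) : Y ^ ((1 : ℝ) / 6) * Y ^ ((5 : ℝ) / 6) = Y := by
  rw [← Real.rpow_add' hY (by norm_num)]; norm_num

/-- **The large-height divisibility count from Theorem 3.2 and Theorem 2.4 (ii), (iii)** (with Prop. 4.5 for the
size of the dual density): there are `C, K ≥ 0` with `#{GL₂(ℤ)-orbits : 0 < α Disc < Y, m²d ∣ Disc} ≤ C 4^{ω(md)} Y/(m²d)`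
for all coprime squarefree `m, d` prime to `6` and `Y ≥ K (m²d)⁵` — the role of BTT Prop. 4.7 in the proof of Prop. 5.1
(`N > Q^{100}`), here obtained from Thm 3.2 applied to the single pair `(Φ_{d,m}, Y)`: hypothesis (16) holds for
`Y ≥ (m²d)⁵` (`hyp16`), (19) for `Y ≥ K(m²d)⁵` (`δ̂₁(Φ) ≤ 2C_U (m²d)⁴`, `Res₁ ≥ β/(m²d)`), and then
`N(Y, Φ) ≤ Res₁ Y + (6/5)|Res_{5/6}| Y^{5/6} + C Y^{3/5} Res₁^{3/5} δ̂₁^{2/5} ≤ (1 + (6/5)c₁₆ + C) Res₁ Y`,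
`Res₁ ≤ (α⁻+β) 2^{ω(md)}/(m²d)`, `#orbits ≤ 12 N(Y, Φ)`.
[cite: BhargavaTaniguchiThorne2023, Thm 3.2 with Thm 2.4 (cases Φ_p, Φ_{p²}) and Prop. 4.7 (its use for N > Q^{100} in §5)] -/
theorem divCountBound_of_landau (hU : btt_uniformity_sqDvd)
    (h32 : ∀ c₁₆ c₁₉ cL cU : ℝ, 0 < c₁₆ → 0 < c₁₉ → 0 < cL → cL ≤ cU → ∃ C : ℝ, LandauAverageBound c₁₆ c₁₉ cL cU C)
    (h24div : ∀ d m : ℕ, Squarefree d → Squarefree m → d.Coprime m → (d * m).Coprime 6 →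
      ∀ sgn : ℤ, (sgn = 1 ∨ sgn = -1) → HasDivResidues d m sgn) :
    ∃ C K : ℝ, 0 ≤ C ∧ 0 ≤ K ∧ DivCountBound C K := by
  obtain ⟨C_h, hCh⟩ := exists_sum_classNumber_le hU
  have hCh0 : 0 ≤ C_h := by
    have h := hCh 1 (Or.inl rfl) 1
    have h0 : 0 ≤ ∑ D ∈ discWindow 1 1, (classNumber D : ℝ) := Finset.sum_nonneg fun _ _ => Nat.cast_nonneg _
    simpa using h0.trans h
  have hβ := shintaniBeta_pos
  set Γ : ℝ := |shintaniGamma 1| + |shintaniGamma (-1)| with hΓ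
  set c₁₆ : ℝ := Γ / shintaniBeta + 1 with hc₁₆
  have hc₁₆0 : 0 < c₁₆ := by rw [hc₁₆]; positivity
  obtain ⟨C_L, hCL⟩ := h32 c₁₆ 1 1 1 hc₁₆0 one_pos one_pos le_rfl
  set C_L' : ℝ := max C_L 0 with hCL'
  have hCL'0 : 0 ≤ C_L' := le_max_right _ _
  set K : ℝ := max 1 (2 * C_h / shintaniBeta) with hK
  have hK1 : 1 ≤ K := le_max_left _ _
  have hK2 : 2 * C_h / shintaniBeta ≤ K := le_max_right _ _
  set A : ℝ := shintaniAlpha (-1) + shintaniBeta with hA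
  have hA0 : 0 < A := add_pos (shintaniAlpha_pos (-1)) hβ
  refine ⟨12 * (1 + 6 / 5 * c₁₆ + C_L') * A, K, by positivity, by linarith, ?_⟩
  intro α hα m d hm hd hmd h6 Y hY
  -- the level and the function
  have hm0 : (0 : ℝ) < m := by exact_mod_cast Nat.pos_of_ne_zero hm.ne_zero
  have hd0 : (0 : ℝ) < d := by exact_mod_cast Nat.pos_of_ne_zero hd.ne_zero
  set M : ℕ := m ^ 2 * d with hMdef
  have hMr : (M : ℝ) = (m : ℝ) ^ 2 * d := by rw [hMdef]; push_cast; ring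
  have hM0 : (0 : ℝ) < (m : ℝ) ^ 2 * d := by positivity
  have hMpos : 0 < M := by rw [hMdef]; exact Nat.pos_of_ne_zero (mul_ne_zero (pow_ne_zero 2 hm.ne_zero) hd.ne_zero)
  haveI : NeZero M := ⟨hMpos.ne'⟩
  have hm6 : m.Coprime 6 := Nat.Coprime.coprime_dvd_left (Dvd.intro d rfl) h6
  have hd6 : d.Coprime 6 := Nat.Coprime.coprime_dvd_left (Dvd.intro_left m rfl) h6
  have hres : HasDivResidues d m α := h24div d m hd hm hmd.symm (by rwa [mul_comm]) α hα
  -- heights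
  have hM5 : ((m : ℝ) ^ 2 * d) ^ 5 ≤ Y := le_trans (le_mul_of_one_le_left (by positivity) hK1) hY
  have hY1 : (1 : ℝ) ≤ Y := by
    refine le_trans ?_ hM5
    have h1 : (1 : ℝ) ≤ (m : ℝ) ^ 2 * d := by
      have := Nat.one_le_iff_ne_zero.mpr hMpos.ne'
      rw [← hMr]; exact_mod_cast this
    exact one_le_pow₀ h1
  have hY0 : 0 ≤ Y := by linarith
  -- the residue at `1`
  set R : ℝ := (shintaniRes1 (divIndicator d m) α).re with hRdef
  have hRlow : shintaniBeta / ((m : ℝ) ^ 2 * d) ≤ R := hres.lower hd hm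
  have hR0 : 0 < R := lt_of_lt_of_le (by positivity) hRlow
  have hRup : R ≤ A * 2 ^ (m * d).primeFactors.card / ((m : ℝ) ^ 2 * d) := hres.upper hd hm hmd
  have hRnorm : ‖shintaniRes1 (divIndicator d m) α‖ = R := by rw [hres.norm_shintaniRes1, hRdef, hres.re_shintaniRes1]
  -- the dual density
  have hδ : dualDensity (divIndicator d m) ≤ (M : ℝ) ^ 4 * (2 * 1 * C_h) :=
    dualDensity_le_explicit hCh zero_le_one (norm_divIndicator_le d m)
  have hδ0 : 0 ≤ dualDensity (divIndicator d m) := dualDensity_nonneg _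
  have h19 : dualDensity (divIndicator d m) ≤ 1 * Y * R := by
    refine hδ.trans ?_
    rw [one_mul, hMr]
    -- `M⁴ · 2C_h ≤ Y · β/M ≤ Y R`
    have h1 : ((m : ℝ) ^ 2 * d) ^ 4 * (2 * 1 * C_h) ≤ Y * (shintaniBeta / ((m : ℝ) ^ 2 * d)) := by
      rw [mul_div_assoc', le_div_iff₀ hM0]
      calc ((m : ℝ) ^ 2 * d) ^ 4 * (2 * 1 * C_h) * ((m : ℝ) ^ 2 * d) = (2 * C_h / shintaniBeta) * ((m : ℝ) ^ 2 * d) ^ 5 * shintaniBeta := by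
            field_simp
          _ ≤ K * ((m : ℝ) ^ 2 * d) ^ 5 * shintaniBeta := by gcongr
          _ ≤ Y * shintaniBeta := mul_le_mul_of_nonneg_right hY hβ.le
    exact h1.trans (mul_le_mul_of_nonneg_left hRlow hY0)
  -- Theorem 3.2 for the singleton family
  have hmain := hCL α hα Unit {()} (fun _ => M) (fun _ => divIndicator d m) (fun _ => Y) Y hY1
    (fun _ _ => hMpos)
    (fun _ _ y => divIndicator_nonneg d m y)
    (fun _ _ γ hγ y => divIndicator_twist d m hγ y)
    (fun _ _ => ⟨by rw [one_mul], by rw [one_mul]⟩)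
    (fun _ _ => hres.hyp16 hα hd hm hd6 hm6 hM5)
    (by rw [Finset.sum_singleton, Finset.sum_singleton]; exact h19)
  rw [Finset.sum_singleton, Finset.sum_singleton, Finset.sum_singleton] at hmain
  rw [← hRdef] at hmain
  -- the norm of the partial sum
  set Φ := divIndicator d m with hΦ
  set Nval : ℂ := shintaniPartialSum Φ α Y with hNval
  set A' : ℂ := shintaniRes1 Φ α * (Y : ℂ) with hA'
  set B' : ℂ := (6 / 5 : ℂ) * shintaniRes56 Φ α * (((Y ^ ((5 : ℝ) / 6) : ℝ)) : ℂ) with hB'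
  have h16 := hres.hyp16 hα hd hm hd6 hm6 hM5
  rw [hRnorm] at h16
  have herr : C_L * Y ^ ((3 : ℝ) / 5) * R ^ ((3 : ℝ) / 5) * (dualDensity Φ) ^ ((2 : ℝ) / 5) ≤ C_L' * (Y * R) := by
    have hx0 : 0 ≤ Y ^ ((3 : ℝ) / 5) * R ^ ((3 : ℝ) / 5) * (dualDensity Φ) ^ ((2 : ℝ) / 5) := by positivity
    calc C_L * Y ^ ((3 : ℝ) / 5) * R ^ ((3 : ℝ) / 5) * (dualDensity Φ) ^ ((2 : ℝ) / 5)
        = C_L * (Y ^ ((3 : ℝ) / 5) * R ^ ((3 : ℝ) / 5) * (dualDensity Φ) ^ ((2 : ℝ) / 5)) := by ring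
      _ ≤ C_L' * (Y ^ ((3 : ℝ) / 5) * R ^ ((3 : ℝ) / 5) * (dualDensity Φ) ^ ((2 : ℝ) / 5)) :=
          mul_le_mul_of_nonneg_right (le_max_left _ _) hx0
      _ ≤ C_L' * (Y ^ ((3 : ℝ) / 5) * R ^ ((3 : ℝ) / 5) * (Y * R) ^ ((2 : ℝ) / 5)) := by
          refine mul_le_mul_of_nonneg_left (mul_le_mul_of_nonneg_left ?_ (by positivity)) hCL'0
          exact Real.rpow_le_rpow hδ0 (by rw [one_mul] at h19; exact h19) (by norm_num)
      _ = C_L' * (Y * R) := by rw [rpow_three_fifths_mul hY0 hR0.le]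
  have hA'norm : ‖A'‖ = R * Y := by
    rw [hA', norm_mul, hRnorm, Complex.norm_real, Real.norm_of_nonneg hY0]
  have hB'norm : ‖B'‖ ≤ 6 / 5 * c₁₆ * R * Y := by
    rw [hB', norm_mul, norm_mul, Complex.norm_real, Real.norm_of_nonneg (Real.rpow_nonneg hY0 _),
      show (6 / 5 : ℂ) = ((6 / 5 : ℝ) : ℂ) by push_cast; ring, Complex.norm_real, Real.norm_of_nonneg (by norm_num)]
    calc 6 / 5 * ‖shintaniRes56 Φ α‖ * Y ^ ((5 : ℝ) / 6) ≤ 6 / 5 * (c₁₆ * Y ^ ((1 : ℝ) / 6) * R) * Y ^ ((5 : ℝ) / 6) :=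
          mul_le_mul_of_nonneg_right (mul_le_mul_of_nonneg_left h16 (by norm_num)) (Real.rpow_nonneg hY0 _)
      _ = 6 / 5 * c₁₆ * R * (Y ^ ((1 : ℝ) / 6) * Y ^ ((5 : ℝ) / 6)) := by ring
      _ = 6 / 5 * c₁₆ * R * Y := by rw [rpow_sixth_mul_rpow_five_sixths hY0]
  have hNnorm : ‖Nval‖ ≤ (1 + 6 / 5 * c₁₆ + C_L') * R * Y := by
    have htri : ‖Nval‖ ≤ ‖Nval - A' - B'‖ + ‖A'‖ + ‖B'‖ := by
      have h : ‖(Nval - A' - B') + A' + B'‖ ≤ ‖Nval - A' - B'‖ + ‖A'‖ + ‖B'‖ := norm_add₃_le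
      rwa [show Nval - A' - B' + A' + B' = Nval by ring] at h
    have h1 : ‖Nval - A' - B'‖ ≤ C_L' * (Y * R) := hmain.trans herr
    rw [hA'norm] at htri
    nlinarith [htri, h1, hB'norm]
  -- conclusion
  have hcount := ncard_divFam_le_re_partialSum hα hmd Y
  have h2le4 : (2 : ℝ) ^ (m * d).primeFactors.card ≤ 4 ^ (m * d).primeFactors.card :=
    pow_le_pow_left₀ (by norm_num) (by norm_num) _
  have hfac : 0 ≤ 12 * (1 + 6 / 5 * c₁₆ + C_L') := by positivity
  calc ((divFam α Y m d ∅ ∅).ncard : ℝ) ≤ 12 * Nval.re := hcount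
    _ ≤ 12 * ‖Nval‖ := mul_le_mul_of_nonneg_left (Complex.re_le_norm _) (by norm_num)
    _ ≤ 12 * ((1 + 6 / 5 * c₁₆ + C_L') * R * Y) := mul_le_mul_of_nonneg_left hNnorm (by norm_num)
    _ = 12 * (1 + 6 / 5 * c₁₆ + C_L') * Y * R := by ring
    _ ≤ 12 * (1 + 6 / 5 * c₁₆ + C_L') * Y * (A * 2 ^ (m * d).primeFactors.card / ((m : ℝ) ^ 2 * d)) :=
        mul_le_mul_of_nonneg_left hRup (by positivity)
    _ ≤ 12 * (1 + 6 / 5 * c₁₆ + C_L') * Y * (A * 4 ^ (m * d).primeFactors.card / ((m : ℝ) ^ 2 * d)) := by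
        refine mul_le_mul_of_nonneg_left ?_ (by positivity)
        exact div_le_div_of_nonneg_right (mul_le_mul_of_nonneg_left h2le4 hA0.le) hM0.le
    _ = 12 * (1 + 6 / 5 * c₁₆ + C_L') * A * 4 ^ (m * d).primeFactors.card * Y / ((m : ℝ) ^ 2 * d) := by ring

end DivResidues

end Literature.NumberTheory.CubicFields

end
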